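import Literature.NumberTheory.LFunctions.WeilTwoPrimeDeflL2Base
import Literature.NumberTheory.LFunctions.WeilBlockRowsPZ
import HarnessLib

/-!
# Deflated two-prime certificate L2: the factored even inverse agrees with `D`, rows 56–63

`WeilCert.checkDnRow` (even block) for certificate L2, by `decide +kernel`. Pure proof file.
-/

noncomputable section

namespace Literature.NumberTheory.LFunctions

set_option maxHeartbeats 0 in
/-- Row 56 of `DnE/LsE` is row 56 of the even `D` (certificate L2). [folklore] -/
theorem checkDnRow0_56_weilCertDeflL2 : weilCertDeflL2Base.checkDnRow weilCertDeflL2DnE weilCertDeflL2LsE 0 56 = true := by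
  decide +kernel

set_option maxHeartbeats 0 in
/-- Row 57 of `DnE/LsE` is row 57 of the even `D` (certificate L2). [folklore] -/
theorem checkDnRow0_57_weilCertDeflL2 : weilCertDeflL2Base.checkDnRow weilCertDeflL2DnE weilCertDeflL2LsE 0 57 = true := by
  decide +kernel

set_option maxHeartbeats 0 in
/-- Row 58 of `DnE/LsE` is row 58 of the even `D` (certificate L2). [folklore] -/
theorem checkDnRow0_58_weilCertDeflL2 : weilCertDeflL2Base.checkDnRow weilCertDeflL2DnE weilCertDeflL2LsE 0 58 = true := by
  decide +kernel

set_option maxHeartbeats 0 in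
/-- Row 59 of `DnE/LsE` is row 59 of the even `D` (certificate L2). [folklore] -/
theorem checkDnRow0_59_weilCertDeflL2 : weilCertDeflL2Base.checkDnRow weilCertDeflL2DnE weilCertDeflL2LsE 0 59 = true := by
  decide +kernel

set_option maxHeartbeats 0 in
/-- Row 60 of `DnE/LsE` is row 60 of the even `D` (certificate L2). [folklore] -/
theorem checkDnRow0_60_weilCertDeflL2 : weilCertDeflL2Base.checkDnRow weilCertDeflL2DnE weilCertDeflL2LsE 0 60 = true := by
  decide +kernel

set_option maxHeartbeats 0 in
/-- Row 61 of `DnE/LsE` is row 61 of the even `D` (certificate L2). [folklore] -/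
theorem checkDnRow0_61_weilCertDeflL2 : weilCertDeflL2Base.checkDnRow weilCertDeflL2DnE weilCertDeflL2LsE 0 61 = true := by
  decide +kernel

set_option maxHeartbeats 0 in
/-- Row 62 of `DnE/LsE` is row 62 of the even `D` (certificate L2). [folklore] -/
theorem checkDnRow0_62_weilCertDeflL2 : weilCertDeflL2Base.checkDnRow weilCertDeflL2DnE weilCertDeflL2LsE 0 62 = true := by
  decide +kernel

set_option maxHeartbeats 0 in
/-- Row 63 of `DnE/LsE` is row 63 of the even `D` (certificate L2). [folklore] -/
theorem checkDnRow0_63_weilCertDeflL2 : weilCertDeflL2Base.checkDnRow weilCertDeflL2DnE weilCertDeflL2LsE 0 63 = true := by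
  decide +kernel


end Literature.NumberTheory.LFunctions
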